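import Mathlib.CategoryTheory.SingleObj
import Literature.AlgebraicGeometry.Frobenioids.UnitsFunctorProofs
import HarnessLib

/-!
# Frobenioids I, Prop. 2.2 (ii)/(iii): the named statements `UnitsFunctorExistsUnique F` and
# `UnitsFunctorData.DivNatural O` are SCHEMATA over an arbitrary functor `F : C → F_Φ` — their universal
# closures (no "Frobenioid" hypothesis among the binders) are FALSE; the instance forms are the landed
# `unitsFunctorExistsUnique_holds hF`, `UnitsFunctorData.divNatural_holds hF`

Mochizuki, *The geometry of Frobenioids I: the general theory*, Kyushu J. Math. **62** (2008) 293–400,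
Proposition 2.2 (ii), (iii), kurims text p. 45: "Let `C` be a FROBENIOID. … (ii) There is a unique
contravariant functor `D* → Mon`, `A ↦ O^▷(A)` … (iii) … `Div : O^▷(A) → Φ(A)` … functorial"
[cite: MochizukiFrdI2008, Prop. 2.2(ii) p.45] [cite: MochizukiFrdI2008, Prop. 2.2(iii) p.45].

PROOF-ONLY companion (cell abc-iut, block F fact-proving wave, seat abc-iut-f-043; FACT-LIST rows F-1297
`PreFrobenioid.UnitsFunctorExistsUnique` and F-1296 `PreFrobenioid.UnitsFunctorData.DivNatural` of
`plan/FACT-LIST.md`, `kernel_closedness = parametrised`, R7-demoted to "proved under a standing hypothesis only").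
No definitions, nothing re-typed; the declaring file `UnitsFunctor.lean` (abc-iut-L1-t2) is imported, never edited.

WHAT THE KERNEL RECORDS. Both named statements are typed over
`{D} [Category D] {Φ : Dᵒᵖ ⥤ CommMonCat} {C} [Category C] (F : C ⥤ ElemFrobenioid Φ)` WITHOUT the print's
standing hypothesis "`C` a Frobenioid" (which enters only the discharges `unitsFunctorExistsUnique_holds hF`,
`UnitsFunctorData.divNatural_holds hF`, abc-iut-L1-t2). AS TYPED the universal closures fail at a one-object toy
(universe `0`): base `D = B(ℕ)` (one object, endomorphisms `(ℕ, +)`), `Φ` the CONSTANT functor (so every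
pull-back is the identity), `C = B(ℤ)` (one object, endomorphisms the commutative GROUP `ℤ`, so every arrow is an
isomorphism and the object is isotropic), and `F : C → F_Φ` with `Base ≡ id`, `deg_Fr ≡ 1`. Then
`O^▷(⋆) = End(⋆) = ℤ`, the linear arrows all lie over `id`, and a "units functor datum" is exactly a monoid action
of `(ℕ, +)` on `ℤ` by monoid endomorphisms — e.g. the trivial one and `n ↦ (x ↦ (-1)ⁿ x)`:
* `not_forall_unitsFunctorExistsUnique` (F-1297): with `Div ≡ 0` (`Φ ≡ 1`), two distinct data exist, so
  `Subsingleton (UnitsFunctorData F)` fails;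
* `not_forall_divNatural` (F-1296): with `Φ ≡ ℤ` and `Div = id`, the inversion datum has
  `Div(O^▷(1)(x)) = -x ≠ x = 1^*(Div x)`.
So F-1296 / F-1297 are: universal closure REFUTED; instance forms (for a Frobenioid, as printed) PROVED — R5
schema rows; consumers keep the hypothesis `hF : IsFrobenioid F`. Nothing here bears on [IUTchIII] Cor. 3.12 or
asserts anything about abc.
-/

namespace Literature.AlgebraicGeometry.Frobenioids

open CategoryTheory Opposite

namespace PreFrobenioid

/-- In the one-object category `B(G)` of a group every arrow is an isomorphism, so for ANY functor
`F : B(G) → F_Φ` the object is isotropic (Def. 1.2 (iv): isometric pre-steps out of it are isomorphisms).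
[cite: MochizukiFrdI2008, Def. 1.2(iv)] -/
theorem isIsotropic_singleObj_group {D : Type} [Category.{0} D] {Φ : Dᵒᵖ ⥤ CommMonCat.{0}}
    (G : Type) [Group G] (F : SingleObj G ⥤ ElemFrobenioid Φ) (X : SingleObj G) : IsIsotropic F X :=
  fun _ ψ _ _ => IsIso.of_groupoid ψ

/-- **F-1297, universal closure AS TYPED is false** (Prop. 2.2 (ii) without "`C` a Frobenioid"): over
`D = B(ℕ)`, `Φ ≡ 1`, `C = B(ℤ)`, `F ≡ (id, 0, 1)`, the units-functor data are the monoid actions of `(ℕ, +)` on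
`O^▷(⋆) = ℤ`; the trivial action and `n ↦ (−1)ⁿ` are two of them. The instance form for a Frobenioid is
abc-iut-L1-t2's `unitsFunctorExistsUnique_holds`. [cite: MochizukiFrdI2008, Prop. 2.2(ii) p.45] -/
theorem not_forall_unitsFunctorExistsUnique :
    ¬ ∀ {D : Type} [Category.{0} D] {Φ : Dᵒᵖ ⥤ CommMonCat.{0}} {C : Type} [Category.{0} C]
        (F : C ⥤ ElemFrobenioid Φ), UnitsFunctorExistsUnique F := by
  intro h
  -- the toy: base `B(ℕ)`, trivial `Φ`, total category `B(ℤ)`, constant functor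
  let N := Multiplicative ℕ
  let G := Multiplicative ℤ
  let Φ : (SingleObj N)ᵒᵖ ⥤ CommMonCat.{0} := (Functor.const _).obj (CommMonCat.of PUnit)
  let F : SingleObj G ⥤ ElemFrobenioid Φ :=
    (Functor.const _).obj (ElemFrobenioid.of Φ (SingleObj.star N))
  obtain ⟨-, hsub⟩ := h F
  -- every endomorphism of the object is base-identity and linear
  have hmem : ∀ (X : SingleObj G) (g : End X), g ∈ endSubmonoid F X := fun X g => ⟨rfl, rfl⟩
  -- the inversion of `O^▷(X) = ℤ`
  let ι (X : (isotropicObjects F).FullSubcategory) : Monoid.End (endSubmonoid F X.obj) :=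
    { toFun := fun e => ⟨(show G from e.1)⁻¹, hmem X.obj _⟩
      map_one' := Subtype.ext (by
        show ((show G from (1 : End X.obj)))⁻¹ = (1 : End X.obj)
        exact inv_one)
      map_mul' := fun a b => Subtype.ext (by
        show (show G from a.1 * b.1)⁻¹ = (show G from a.1)⁻¹ * (show G from b.1)⁻¹
        exact mul_inv _ _) }
  have hι : ∀ (X : (isotropicObjects F).FullSubcategory) (e : endSubmonoid F X.obj),
      ((ι X e).1 : G) = (show G from e.1)⁻¹ := fun X e => rfl
  -- res_base for any datum whose value over `id = 1 ∈ ℕ` is the identity: `B(ℤ)` is commutative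
  have hcomm : ∀ {A B : (isotropicObjects F).FullSubcategory} (φ : A.obj ⟶ B.obj) (β : endSubmonoid F B.obj)
      (α : endSubmonoid F A.obj), (α.1 : G) = (β.1 : G) →
      φ ≫ (show B.obj ⟶ B.obj from β.1) = (show A.obj ⟶ A.obj from α.1) ≫ φ := by
    intro A B φ β α hαβ
    show (show G from β.1) * (show G from φ) = (show G from φ) * (show G from α.1)
    rw [mul_comm]
    exact congrArg _ hαβ.symm
  -- datum 1: the trivial action
  let O₁ : UnitsFunctorData F :=
    { res := fun {A B} _ => ⟨⟨fun β => ⟨(β.1 : G), hmem A.obj _⟩, rfl⟩, fun _ _ => rfl⟩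
      res_id := fun A α => rfl
      res_comp := fun f g γ => rfl
      res_base := fun {A B} φ _ β => hcomm φ β _ rfl }
  -- datum 2: `n ↦ inversionⁿ`
  let O₂ : UnitsFunctorData F :=
    { res := fun {A B} f =>
        MonoidHom.comp ((ι A) ^ (Multiplicative.toAdd (show N from f)))
          ⟨⟨fun β => ⟨(β.1 : G), hmem A.obj _⟩, rfl⟩, fun _ _ => rfl⟩
      res_id := fun A α => by
        show ((ι A) ^ (Multiplicative.toAdd (1 : N))) _ = α
        rw [toAdd_one, pow_zero]
        rfl
      res_comp := fun {A B B'} f g γ => by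
        apply Subtype.ext
        show (((ι A) ^ (Multiplicative.toAdd ((show N from g) * (show N from f)))) _).1 =
          (((ι A) ^ (Multiplicative.toAdd (show N from f))) _).1
        rw [toAdd_mul, add_comm, pow_add, Monoid.End.coe_mul, Function.comp_apply]
        rfl
      res_base := fun {A B} φ _ β => by
        apply hcomm φ β
        show (((ι A) ^ (Multiplicative.toAdd (1 : N))) _).1 = _
        rw [toAdd_one, pow_zero]
        rfl }
  -- the two data differ at `f = 1 ∈ ℕ`, `β = 1 ∈ ℤ`
  have heq : O₁ = O₂ := hsub.elim O₁ O₂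
  let A : (isotropicObjects F).FullSubcategory :=
    ⟨SingleObj.star G, isIsotropic_singleObj_group G F _⟩
  let β : endSubmonoid F A.obj := ⟨(Multiplicative.ofAdd (1 : ℤ) : G), hmem _ _⟩
  have h1 : ((O₁.res (A := A) (B := A) (Multiplicative.ofAdd (1 : ℕ) : N) β).1 : G) =
      Multiplicative.ofAdd (1 : ℤ) := rfl
  have h2 : ((O₂.res (A := A) (B := A) (Multiplicative.ofAdd (1 : ℕ) : N) β).1 : G) =
      (Multiplicative.ofAdd (1 : ℤ))⁻¹ := by
    show (((ι A) ^ (Multiplicative.toAdd (Multiplicative.ofAdd (1 : ℕ)))) _).1 = _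
    rw [toAdd_ofAdd, pow_one, hι]
  rw [heq] at h1
  rw [h1] at h2
  exact absurd (congrArg Multiplicative.toAdd h2) (by decide)

/-- **F-1296, universal closure AS TYPED is false** (Prop. 2.2 (iii) "functorial" without "`C` a Frobenioid"):
over `D = B(ℕ)`, `Φ ≡ ℤ` constant (pull-backs are identities), `C = B(ℤ)`, `F = (id, Div = id, 1)`, the datum
`n ↦ (−1)ⁿ` on `O^▷(⋆) = ℤ` has `Div(O^▷(1)(1)) = −1 ≠ 1 = 1^*(Div 1)`. The instance form for a Frobenioid is
abc-iut-L1-t2's `UnitsFunctorData.divNatural_holds`. [cite: MochizukiFrdI2008, Prop. 2.2(iii) p.45] -/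
theorem not_forall_divNatural :
    ¬ ∀ {D : Type} [Category.{0} D] {Φ : Dᵒᵖ ⥤ CommMonCat.{0}} {C : Type} [Category.{0} C]
        {F : C ⥤ ElemFrobenioid Φ} (O : UnitsFunctorData F), O.DivNatural := by
  intro h
  let N := Multiplicative ℕ
  let G := Multiplicative ℤ
  let Φ : (SingleObj N)ᵒᵖ ⥤ CommMonCat.{0} := (Functor.const _).obj (CommMonCat.of G)
  -- `F`: base `id`, `Div(g) = g`, `deg_Fr = 1`
  let F : SingleObj G ⥤ ElemFrobenioid Φ :=
    { obj := fun _ => ElemFrobenioid.of Φ (SingleObj.star N)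
      map := fun g => ElemFrobenioid.homMk (𝟙 _) (show G from g) 1
      map_id := fun X => rfl
      map_comp := fun f g => by
        refine ElemFrobenioid.Hom.ext rfl ?_ rfl
        change (show G from g) * (show G from f) =
          @HMul.hMul G G G instHMul (pull Φ (𝟙 (SingleObj.star N)) (show G from g))
            ((show G from f) ^ ((1 : ℕ+) : ℕ))
        rw [PNat.one_coe, pow_one]
        rfl }
  have hmem : ∀ (X : SingleObj G) (g : End X), g ∈ endSubmonoid F X := fun X g => ⟨rfl, rfl⟩
  have hdiv : ∀ (X : SingleObj G) (e : endSubmonoid F X), divHom F X e = (show G from e.1) := fun X e => rfl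
  let ι (X : (isotropicObjects F).FullSubcategory) : Monoid.End (endSubmonoid F X.obj) :=
    { toFun := fun e => ⟨(show G from e.1)⁻¹, hmem X.obj _⟩
      map_one' := Subtype.ext (by
        show ((show G from (1 : End X.obj)))⁻¹ = (1 : End X.obj)
        exact inv_one)
      map_mul' := fun a b => Subtype.ext (by
        show (show G from a.1 * b.1)⁻¹ = (show G from a.1)⁻¹ * (show G from b.1)⁻¹
        exact mul_inv _ _) }
  have hι : ∀ (X : (isotropicObjects F).FullSubcategory) (e : endSubmonoid F X.obj),
      ((ι X e).1 : G) = (show G from e.1)⁻¹ := fun X e => rfl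
  have hcomm : ∀ {A B : (isotropicObjects F).FullSubcategory} (φ : A.obj ⟶ B.obj) (β : endSubmonoid F B.obj)
      (α : endSubmonoid F A.obj), (α.1 : G) = (β.1 : G) →
      φ ≫ (show B.obj ⟶ B.obj from β.1) = (show A.obj ⟶ A.obj from α.1) ≫ φ := by
    intro A B φ β α hαβ
    show (show G from β.1) * (show G from φ) = (show G from φ) * (show G from α.1)
    rw [mul_comm]
    exact congrArg _ hαβ.symm
  let O : UnitsFunctorData F :=
    { res := fun {A B} f =>
        MonoidHom.comp ((ι A) ^ (Multiplicative.toAdd (show N from f)))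
          ⟨⟨fun β => ⟨(β.1 : G), hmem A.obj _⟩, rfl⟩, fun _ _ => rfl⟩
      res_id := fun A α => by
        show ((ι A) ^ (Multiplicative.toAdd (1 : N))) _ = α
        rw [toAdd_one, pow_zero]
        rfl
      res_comp := fun {A B B'} f g γ => by
        apply Subtype.ext
        show (((ι A) ^ (Multiplicative.toAdd ((show N from g) * (show N from f)))) _).1 =
          (((ι A) ^ (Multiplicative.toAdd (show N from f))) _).1
        rw [toAdd_mul, add_comm, pow_add, Monoid.End.coe_mul, Function.comp_apply]
        rfl
      res_base := fun {A B} φ _ β => by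
        apply hcomm φ β
        show (((ι A) ^ (Multiplicative.toAdd (show N from Base F φ))) _).1 = _
        rw [show Base F φ = (1 : N) from rfl, toAdd_one, pow_zero]
        rfl }
  have hO : O.DivNatural := h O
  let A : (isotropicObjects F).FullSubcategory :=
    ⟨SingleObj.star G, isIsotropic_singleObj_group G F _⟩
  let β : endSubmonoid F A.obj := ⟨(Multiplicative.ofAdd (1 : ℤ) : G), hmem _ _⟩
  have key := @hO A A (Multiplicative.ofAdd (1 : ℕ) : N) β
  rw [hdiv, hdiv] at key
  have h2 : (show G from (O.res (A := A) (B := A) (Multiplicative.ofAdd (1 : ℕ) : N) β).1) =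
      (Multiplicative.ofAdd (1 : ℤ))⁻¹ := by
    show (((ι A) ^ (Multiplicative.toAdd (Multiplicative.ofAdd (1 : ℕ)))) _).1 = _
    rw [toAdd_ofAdd, pow_one, hι]
  rw [h2] at key
  -- `key : (ofAdd 1)⁻¹ = pull Φ 1 (ofAdd 1)`, and the pull-back of the constant `Φ` is the identity
  have key' : (Multiplicative.ofAdd (1 : ℤ))⁻¹ = Multiplicative.ofAdd (1 : ℤ) := key
  exact absurd (congrArg Multiplicative.toAdd key') (by decide)

end PreFrobenioid

end Literature.AlgebraicGeometry.Frobenioids
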